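/-
Copyright: the b2b-balaban cell (near-miss cell 7), T⁴-continuum fan-out, lineage t4-ne7b-p2 (node U5c RENEWAL member).
Released under the licence of the surrounding project.
-/
import Literature.MathematicalPhysics.QuantumFieldTheory.Balaban1983to89.T4LiveGasToTerms

/-!
# The renewal route's slot gas: per-slot age-decaying pending masses ⇒ the kernel's weight slot

Summits-side support leaf of the T⁴-continuum cell (rung (B)+1 on a FINITE torus only; NOT infinite volume, NOT the
mass gap, NOT the Clay statement; NOT a proof of the spine estimate NE7b).  Lineage `t4-ne7b-p2` (generation 22),
node U5c, RENEWAL route; leaf N4c of the ROUND-2 skeleton `t4/skeletons/NE7b-t4-ne7b-p2.md`.  [folklore] finite sums,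
geometric series and the composition of landed [folklore] leaves BY NAME (`T4LiveGasToTerms`, `T4LiveStructureGas`,
`T4LiveClassFibration`, `T4PersistentHistoryCount.slotBudget_model`, `T4HistoryPeeling.summable_twoRateBudget`); nothing
is quoted from print, nothing printed is asserted, no `[cite:]` tag; none of the cell's conditionals ((B), BetaPertH)
occurs — they stay behind the displayed `Regeneration` binders exactly as in `T4LiveGasToTerms`.

WHAT.  On the renewal route the live slots of the gas are `(birth step j, birth cell z, pending record r)` and the ONE
analytic input on the budget side is a PER-SLOT, AGE-DECAYING bound on the pending product-majorant mass,
`Σ_{r pending at K} ω K j z r ≤ C_F·σ^(K − j)` — the output of the per-slot renewal forest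
(`RenewalGroveSum.sum_le_of_grove_product`, i.e. `T4PersistenceRenewal.ForestDom.sum_le` at reference weight `1`).
§1 the typed slot sets `liveSlotsR` ∕ `oldSlotsR` and their sums.  §2 `liveMassR_le` (the live mass is `K`-UNIFORM:
`≤ C_F·V∕(1 − Λσ)`) and `oldMassR_le` (the old mass is GEOMETRIC in the number of old steps:
`≤ C_F·V·(Λσ)^(K − j⋆K + 1)∕(1 − Λσ)`) from the per-slot bound and the cell counts `#Cell K a ≤ V·Λ^a`, `Λσ < 1`;
the budget `renewalBudget` and its summability under a positive fraction of old steps.  §3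
`exists_relWeightBound_of_slotMasses`: two TERM-level runs in the regeneration reading whose resummed live prices are
dominated by the live-family weights of the slot prices `ω K` ⇒ `∃ K₁ ≥ K₀`, the kernel's `RelWeightBound` with the
saturated bad set and `W = 𝟙_{K ≥ K₁}·C·renewalBudget C_F V (Λσ) j⋆` — `T4LiveGasToTerms.exists_relWeightBound_of_regeneration_liveGas`
with `hold`∕`hlive`∕`hMs` DISCHARGED from the per-slot bound.  §4 a decided toy.

HONEST DEPENDENCY (cell): continuum YM on T⁴ ⇐ BetaPertH ∧ nine spine estimates (0/9 proved); BetaPertH ⇐ (D1) ∧ (D4)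
∧ CAP+tail.  This file changes none of it.
-/

open Finset
open Literature.MathematicalPhysics.QuantumFieldTheory.Balaban1983to89
open T4WeightBudget T4HistoryPeeling T4PersistentHistoryCount T4GlobalDenominator T4LiveClassFibration
open T4LiveStructureGas T4LiveGasToTerms

namespace Summit.QuantumFields.BalabanUV.T4Continuum.RenewalSlotGas

noncomputable section

/-! ## §1 The renewal route's live slots: (birth step, birth cell, pending record) -/

section Slots

variable {γ ρ : Type*}

/-- The type of RENEWAL SLOTS: (birth step, birth cell, pending record). [folklore] -/
abbrev RSlot (γ ρ : Type*) : Type _ := Σ _ : ℕ, Σ _ : γ, ρ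

/-- **THE LIVE SLOTS AT CUTOFF `K`**: births `j ≤ K` (age `K − j`), cells `z ∈ Cell K (K − j)`, records `r ∈ Rec K j z`
still pending at `K`. [folklore] -/
def liveSlotsR (Cell : ℕ → ℕ → Finset γ) (Rec : ℕ → ℕ → γ → Finset ρ) (K : ℕ) : Finset (RSlot γ ρ) :=
  (range (K + 1)).sigma fun j => (Cell K (K - j)).sigma fun z => Rec K j z

/-- **THE OLD SLOTS**: births `j < j⋆ K`. [folklore] -/
def oldSlotsR (Cell : ℕ → ℕ → Finset γ) (Rec : ℕ → ℕ → γ → Finset ρ) (jstar : ℕ → ℕ) (K : ℕ) :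
    Finset (RSlot γ ρ) :=
  (range (jstar K)).sigma fun j => (Cell K (K - j)).sigma fun z => Rec K j z

/-- old slots are live slots (`j⋆ K ≤ K`) [folklore] -/
theorem oldSlotsR_subset_liveSlotsR (Cell : ℕ → ℕ → Finset γ) (Rec : ℕ → ℕ → γ → Finset ρ) {jstar : ℕ → ℕ}
    {K : ℕ} (hj : jstar K ≤ K) : oldSlotsR Cell Rec jstar K ⊆ liveSlotsR Cell Rec K := by
  intro s hs
  simp only [oldSlotsR, liveSlotsR, Finset.mem_sigma, Finset.mem_range] at hs ⊢
  exact ⟨by omega, hs.2.1, hs.2.2⟩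

/-- the sum over the live slots, unfolded [folklore] -/
theorem sum_liveSlotsR_eq (Cell : ℕ → ℕ → Finset γ) (Rec : ℕ → ℕ → γ → Finset ρ) (K : ℕ) (f : RSlot γ ρ → ℝ) :
    ∑ s ∈ liveSlotsR Cell Rec K, f s = ∑ j ∈ range (K + 1), ∑ z ∈ Cell K (K - j), ∑ r ∈ Rec K j z, f ⟨j, z, r⟩ := by
  simp only [liveSlotsR, Finset.sum_sigma]

/-- … and over the old slots [folklore] -/
theorem sum_oldSlotsR_eq (Cell : ℕ → ℕ → Finset γ) (Rec : ℕ → ℕ → γ → Finset ρ) (jstar : ℕ → ℕ) (K : ℕ)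
    (f : RSlot γ ρ → ℝ) :
    ∑ s ∈ oldSlotsR Cell Rec jstar K, f s = ∑ j ∈ range (jstar K), ∑ z ∈ Cell K (K - j), ∑ r ∈ Rec K j z, f ⟨j, z, r⟩ := by
  simp only [oldSlotsR, Finset.sum_sigma]

/-- The record price as a function on slots. [folklore] -/
def rslotPrice (ω : ℕ → γ → ρ → ℝ) (s : RSlot γ ρ) : ℝ := ω s.1 s.2.1 s.2.2

/-- the price of the slot `⟨j, z, r⟩` is `ω j z r` [folklore] -/
@[simp] theorem rslotPrice_mk (ω : ℕ → γ → ρ → ℝ) (j : ℕ) (z : γ) (r : ρ) : rslotPrice ω ⟨j, z, r⟩ = ω j z r := rfl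

/-- membership in the live slots, unfolded [folklore] -/
theorem mem_liveSlotsR {Cell : ℕ → ℕ → Finset γ} {Rec : ℕ → ℕ → γ → Finset ρ} {K : ℕ} {s : RSlot γ ρ} :
    s ∈ liveSlotsR Cell Rec K ↔ s.1 ≤ K ∧ s.2.1 ∈ Cell K (K - s.1) ∧ s.2.2 ∈ Rec K s.1 s.2.1 := by
  simp only [liveSlotsR, Finset.mem_sigma, Finset.mem_range, Nat.lt_succ_iff]

end Slots

/-! ## §2 The two masses from the per-slot age-decaying bound -/

section Masses

variable {γ ρ : Type*}

/-- **THE LIVE MASS IS `K`-UNIFORM**: per-slot pending masses `≤ C_F·σ^(K − j)` and cell counts `≤ V·Λ^(K − j)` with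
`Λσ < 1` give `Σ_{liveSlotsR K} ω ≤ C_F·V·(1∕(1 − Λσ))`. [folklore] -/
theorem liveMassR_le (Cell : ℕ → ℕ → Finset γ) {V Λ : ℝ} (hV : 0 ≤ V) (hΛ : 0 ≤ Λ)
    (hcell : ∀ K a, ((Cell K a).card : ℝ) ≤ V * Λ ^ a) (Rec : ℕ → ℕ → γ → Finset ρ) {K : ℕ} {CF σ : ℝ}
    (hCF : 0 ≤ CF) (hσ : 0 ≤ σ) (hr : Λ * σ < 1) (ω : ℕ → γ → ρ → ℝ)
    (hslot : ∀ j ≤ K, ∀ z ∈ Cell K (K - j), ∑ r ∈ Rec K j z, ω j z r ≤ CF * σ ^ (K - j)) :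
    ∑ s ∈ liveSlotsR Cell Rec K, rslotPrice ω s ≤ CF * V * (1 / (1 - Λ * σ)) := by
  rw [sum_liveSlotsR_eq]
  simp only [rslotPrice_mk]
  calc ∑ j ∈ range (K + 1), ∑ z ∈ Cell K (K - j), ∑ r ∈ Rec K j z, ω j z r
      ≤ ∑ j ∈ range (K + 1), ∑ _z ∈ Cell K (K - j), CF * σ ^ (K - j) :=
        Finset.sum_le_sum fun j hj => Finset.sum_le_sum fun z hz =>
          hslot j (Nat.lt_succ_iff.1 (Finset.mem_range.1 hj)) z hz
    _ ≤ ∑ j ∈ range (K + 1), CF * V * (Λ * σ) ^ (K - j) := by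
        refine Finset.sum_le_sum fun j _ => ?_
        rw [Finset.sum_const, nsmul_eq_mul]
        calc ((Cell K (K - j)).card : ℝ) * (CF * σ ^ (K - j)) ≤ V * Λ ^ (K - j) * (CF * σ ^ (K - j)) :=
              mul_le_mul_of_nonneg_right (hcell K (K - j)) (mul_nonneg hCF (pow_nonneg hσ _))
          _ = CF * V * (Λ * σ) ^ (K - j) := by rw [mul_pow]; ring
    _ = CF * V * ∑ j ∈ range (K + 1), (Λ * σ) ^ (K - j) := by rw [Finset.mul_sum]
    _ ≤ CF * V * (1 / (1 - Λ * σ)) :=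
        mul_le_mul_of_nonneg_left (sum_range_succ_pow_sub_le (mul_nonneg hΛ hσ) hr K) (mul_nonneg hCF hV)

/-- **THE OLD MASS IS GEOMETRIC IN THE NUMBER OF OLD STEPS**:
`Σ_{oldSlotsR K} ω ≤ C_F·V·(Λσ)^(K − j⋆K + 1)∕(1 − Λσ)` (`T4PersistentHistoryCount.slotBudget_model`). [folklore] -/
theorem oldMassR_le (Cell : ℕ → ℕ → Finset γ) {V Λ : ℝ} (hV : 0 ≤ V) (hΛ : 0 ≤ Λ)
    (hcell : ∀ K a, ((Cell K a).card : ℝ) ≤ V * Λ ^ a) (Rec : ℕ → ℕ → γ → Finset ρ) {K : ℕ} {CF σ : ℝ}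
    (hCF : 0 ≤ CF) (hσ : 0 ≤ σ) (hr : Λ * σ < 1) {jstar : ℕ → ℕ} (hj : jstar K ≤ K) (ω : ℕ → γ → ρ → ℝ)
    (hslot : ∀ j ≤ K, ∀ z ∈ Cell K (K - j), ∑ r ∈ Rec K j z, ω j z r ≤ CF * σ ^ (K - j)) :
    ∑ s ∈ oldSlotsR Cell Rec jstar K, rslotPrice ω s ≤ CF * V * ((Λ * σ) ^ (K - jstar K + 1) / (1 - Λ * σ)) := by
  rw [sum_oldSlotsR_eq]
  simp only [rslotPrice_mk]
  exact slotBudget_model (Cell K) hV hΛ hCF hσ hr (hcell K) hj (fun j z => ∑ r ∈ Rec K j z, ω j z r)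
    fun j hjlt z hz => hslot j ((le_of_lt hjlt).trans hj) z hz

/-- **THE RENEWAL BUDGET** `M K` = (old mass majorant) × exp (live mass majorant). [folklore] -/
def renewalBudget (CF V r : ℝ) (jstar : ℕ → ℕ) (K : ℕ) : ℝ :=
  CF * V * (r ^ (K - jstar K + 1) / (1 - r)) * Real.exp (CF * V * (1 / (1 - r)))

/-- the renewal budget is nonnegative [folklore] -/
theorem renewalBudget_nonneg {CF V r : ℝ} (hCF : 0 ≤ CF) (hV : 0 ≤ V) (h0 : 0 ≤ r) (h1 : r < 1) (jstar : ℕ → ℕ)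
    (K : ℕ) : 0 ≤ renewalBudget CF V r jstar K :=
  mul_nonneg (twoRateBudget_nonneg hCF hV h0 h1 jstar K) (Real.exp_pos _).le

/-- **SUMMABILITY** of the renewal budget when a positive fraction of the steps is old, `c·K ≤ K − j⋆K`
(`T4HistoryPeeling.summable_twoRateBudget`). [folklore] -/
theorem summable_renewalBudget {CF V r c : ℝ} (hCF : 0 ≤ CF) (hV : 0 ≤ V) (h0 : 0 < r) (h1 : r < 1) (hc : 0 < c)
    {jstar : ℕ → ℕ} (hfrac : ∀ K : ℕ, c * K ≤ ((K - jstar K : ℕ) : ℝ)) :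
    Summable fun K => renewalBudget CF V r jstar K :=
  (summable_twoRateBudget hCF hV h0 h1 hc hfrac).mul_right _

end Masses

/-! ## §3 Per-slot masses + the regeneration reading ⇒ the kernel's weight slot -/

section End

variable {γ ρ ι κ : Type*} [DecidableEq γ] [DecidableEq ρ] [DecidableEq κ] {l₀ : ℝ} {K₀ : ℕ} {π : ℕ → ι → κ}
  {T : ℕ → Finset ι} {A A' : ℕ → ℝ → ι → ℝ} {Bad' : ℕ → ℝ → Finset κ} {dead dead' : ℕ → ℝ → ι → ℝ}
  {F R F' R' : ℕ → κ → ℝ} {nlow nup mlow mup : ℕ → ℝ → ℝ} {C : ℝ}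

/-- **THE RENEWAL ROUTE'S EXIT INTO THE KERNEL SLOT.**  DATA: cells `Cell K a` of age `a` with `#Cell K a ≤ V·Λ^a`
(the fixed torus), pending records `Rec K j z` with product-majorant prices `ω K j z r ≥ 0`; THE ONE BUDGET-SIDE INPUT:
the per-slot age-decaying bound `Σ_{r ∈ Rec K j z} ω K j z r ≤ C_F·σ^(K − j)` for every slot of every cutoff (the
renewal forest's `ForestDom.sum_le` at reference weight `1`), with `Λσ < 1` (the survival condition at the run tilt);
the matching scale `j⋆ ≤ K` leaving a positive fraction of old steps; live families `str K c ⊆ liveSlotsR K` injective on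
the bad classes and containing an old slot; two TERM-level runs in the regeneration reading
(`T4LiveClassFibration.Regeneration`) whose resummed live prices are dominated by the live-family weights of `ω K`;
`0 ≤ C` ⇒ `∃ K₁ ≥ K₀`, the kernel's `RelWeightBound` for the term families with the saturated bad set emptied below `K₁`
and `W = 𝟙_{K ≥ K₁}·C·renewalBudget C_F V (Λσ) j⋆`.
Proof: `T4LiveGasToTerms.exists_relWeightBound_of_regeneration_liveGas` with `hold`∕`hlive`∕`hMs` from §2. [folklore] -/
theorem exists_relWeightBound_of_slotMasses (Cell : ℕ → ℕ → Finset γ) {V Λ : ℝ} (hV : 0 ≤ V) (hΛ : 0 < Λ)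
    (hcell : ∀ K a, ((Cell K a).card : ℝ) ≤ V * Λ ^ a) (Rec : ℕ → ℕ → γ → Finset ρ)
    (ω : ℕ → ℕ → γ → ρ → ℝ) (hω0 : ∀ K, ∀ j ≤ K, ∀ z ∈ Cell K (K - j), ∀ r ∈ Rec K j z, 0 ≤ ω K j z r)
    {CF σ : ℝ} (hCF : 0 ≤ CF) (hσ : 0 < σ) (hr : Λ * σ < 1)
    (hslot : ∀ K, ∀ j ≤ K, ∀ z ∈ Cell K (K - j), ∑ r ∈ Rec K j z, ω K j z r ≤ CF * σ ^ (K - j))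
    (jstar : ℕ → ℕ) (hj : ∀ K, jstar K ≤ K) {c : ℝ} (hc : 0 < c)
    (hfrac : ∀ K : ℕ, c * K ≤ ((K - jstar K : ℕ) : ℝ))
    (str : ℕ → κ → Finset (RSlot γ ρ))
    (hinj : ∀ K t, |t| ≤ l₀ → K₀ ≤ K → Set.InjOn (str K) (Bad' K t))
    (hstr : ∀ K t, |t| ≤ l₀ → K₀ ≤ K → ∀ c ∈ Bad' K t,
      str K c ⊆ liveSlotsR Cell Rec K ∧ ∃ o ∈ oldSlotsR Cell Rec jstar K, o ∈ str K c)
    (hA : Regeneration l₀ π T A Bad' dead F R nlow nup C K₀)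
    (hA' : Regeneration l₀ π T A' Bad' dead' F' R' mlow mup C K₀)
    (hF : ∀ K t, |t| ≤ l₀ → K₀ ≤ K → ∀ c ∈ Bad' K t, F K c * R K c ≤ famWeight (rslotPrice (ω K)) (str K c))
    (hF' : ∀ K t, |t| ≤ l₀ → K₀ ≤ K → ∀ c ∈ Bad' K t, F' K c * R' K c ≤ famWeight (rslotPrice (ω K)) (str K c))
    (hC : 0 ≤ C) :
    ∃ K₁, K₀ ≤ K₁ ∧ RelWeightBound l₀ T A A' (fun K t => if K₁ ≤ K then badOfClass π T Bad' K t else ∅)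
      (Set.indicator {K | K₁ ≤ K} (fun K => C * renewalBudget CF V (Λ * σ) jstar K)) := by
  have hr0 : 0 < Λ * σ := mul_pos hΛ hσ
  have hq : ∀ K, ∀ s ∈ liveSlotsR Cell Rec K, 0 ≤ rslotPrice (ω K) s := by
    intro K s hs
    obtain ⟨h1, h2, h3⟩ := mem_liveSlotsR.1 hs
    exact hω0 K s.1 h1 s.2.1 h2 s.2.2 h3
  have hmold0 : ∀ K, 0 ≤ CF * V * ((Λ * σ) ^ (K - jstar K + 1) / (1 - Λ * σ)) :=
    fun K => twoRateBudget_nonneg hCF hV hr0.le hr jstar K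
  have hold : ∀ K, K₀ ≤ K →
      ∑ o ∈ oldSlotsR Cell Rec jstar K, rslotPrice (ω K) o ≤ CF * V * ((Λ * σ) ^ (K - jstar K + 1) / (1 - Λ * σ)) :=
    fun K _ => oldMassR_le Cell hV hΛ.le hcell Rec hCF hσ.le hr (hj K) (ω K) (hslot K)
  have hlive : ∀ K, K₀ ≤ K → ∑ s ∈ liveSlotsR Cell Rec K, rslotPrice (ω K) s ≤ CF * V * (1 / (1 - Λ * σ)) :=
    fun K _ => liveMassR_le Cell hV hΛ.le hcell Rec hCF hσ.le hr (ω K) (hslot K)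
  have hMs : Summable fun K => CF * V * ((Λ * σ) ^ (K - jstar K + 1) / (1 - Λ * σ)) *
      Real.exp (CF * V * (1 / (1 - Λ * σ))) :=
    summable_renewalBudget hCF hV hr0 hr hc hfrac
  exact exists_relWeightBound_of_regeneration_liveGas (fun K => liveSlotsR Cell Rec K)
    (fun K => oldSlotsR Cell Rec jstar K) (fun K => oldSlotsR_subset_liveSlotsR Cell Rec (hj K))
    (fun K => rslotPrice (ω K)) hq str hinj hstr hmold0 hold hlive hMs hA hA' hF hF' hC

end End

/-! ## §4 A decided toy: one cell per age, one pending record per slot of price `(1∕4)^age`, `Λ = 1`, `σ = 1∕4` -/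

section Toy

/-- **THE TWO MASSES ON A TOY**: cells `Cell K a = {a}` (`V = 1`, `Λ = 1`), one record per slot (`Rec K j z = {0}`)
of price `(1∕4)^(K − j)` (`C_F = 1`, `σ = 1∕4`): live mass `≤ 1·1·(1∕(1 − 1∕4)) = 4∕3`, old mass at `j⋆ K = K∕2`
`≤ (1∕4)^(K − K∕2 + 1)∕(3∕4)`. [folklore] -/
example (K : ℕ) :
    ∑ s ∈ liveSlotsR (fun _ a => ({a} : Finset ℕ)) (fun _ _ _ => ({0} : Finset ℕ)) K,
        rslotPrice (fun j _ _ => ((1 : ℝ) / 4) ^ (K - j)) s ≤ 1 * 1 * (1 / (1 - 1 * (1 / 4))) ∧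
      ∑ s ∈ oldSlotsR (fun _ a => ({a} : Finset ℕ)) (fun _ _ _ => ({0} : Finset ℕ)) (fun K => K / 2) K,
        rslotPrice (fun j _ _ => ((1 : ℝ) / 4) ^ (K - j)) s ≤
          1 * 1 * ((1 * (1 / 4)) ^ (K - K / 2 + 1) / (1 - 1 * (1 / 4))) := by
  have hcell : ∀ (K a : ℕ), ((({a} : Finset ℕ)).card : ℝ) ≤ 1 * (1 : ℝ) ^ a := fun _ _ => by simp
  have hslot : ∀ j ≤ K, ∀ z ∈ ({K - j} : Finset ℕ),
      ∑ r ∈ ({0} : Finset ℕ), (fun (j : ℕ) (_ : ℕ) (_ : ℕ) => ((1 : ℝ) / 4) ^ (K - j)) j z r ≤ 1 * (1 / 4 : ℝ) ^ (K - j) :=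
    fun j _ z _ => by simp
  exact ⟨liveMassR_le (fun _ a => ({a} : Finset ℕ)) zero_le_one zero_le_one hcell _ zero_le_one (by norm_num)
      (by norm_num) _ hslot,
    oldMassR_le (fun _ a => ({a} : Finset ℕ)) zero_le_one zero_le_one hcell _ zero_le_one (by norm_num) (by norm_num)
      (Nat.div_le_self K 2) _ hslot⟩

/-- the numbers of the toy at `K = 6`: live mass `Σ_{j ≤ 6} (1/4)^(6−j) = 5461∕4096 ≤ 4∕3`, old mass
`Σ_{j < 3} (1/4)^(6−j) = 21∕4096 ≤ (1∕4)^4∕(3∕4) = 1∕192`, decided -/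
example : ∑ j ∈ range 7, ((1 : ℚ) / 4) ^ (6 - j) = 5461 / 4096 ∧ (5461 : ℚ) / 4096 ≤ 4 / 3 ∧
    ∑ j ∈ range 3, ((1 : ℚ) / 4) ^ (6 - j) = 21 / 4096 ∧ (21 : ℚ) / 4096 ≤ (1 / 4) ^ 4 / (3 / 4) := by
  refine ⟨?_, by norm_num, ?_, by norm_num⟩ <;> simp [Finset.sum_range_succ] <;> norm_num

end Toy

end

end Summit.QuantumFields.BalabanUV.T4Continuum.RenewalSlotGas
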